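import Mathlib
import Summits.Ventures.FusionMHD.Models.SAlphaPolyWitnessS15A095Panels0
import HarnessLib

/-!
# F3 «F3.BALLOON-sα-S15-A095-POLY-WITNESS»: at `(s, α) = (3/2, 19/20)` the `s–α` ballooning MODEL is on the UNSTABLE side — an explicit polynomial trial function on the window `[−8, 8]` with kernel-certified NEGATIVE energy (`SAlpha.UnstableWitness (3/2) (19/20) (−8) 8`); the UPPER end of the `s = 3/2` bracket of record `[3/4, 21/20]` moves to `19/20`

LADDER-GRIDFUSION rung F3 (cell `gridfusion`; DIRECTOR RULING 67 (3) / lead g14 RULING 9ft (7): at `s = 3/2` the bracket of record is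
`[3/4, 21/20]` (★ #220, width `3/10`); a COUNTED half-gap END MOVE is a tree theorem putting the edge inside a sub-interval of width
`≤ 3/20`; THIS file supplies the UPPER end `19/20` ⇒ width `1/5`; NOT yet a halving of `[3/4, 21/20]` (width `3/10`) — that needs a stable end at `α ≥ 4/5` as well).  Assembly by gridfusion-model-7 g9, 2026-08-28, in model-7's
poly-witness lane (g8, ★ #231 `SAlphaPolyWitnessS2A125*`) of (i) the data file `SAlphaPolyWitnessS15A095Defs` (the even degree-26 polynomial `X = UX`,
`X(±8) = 0`, and the 22-statement density program `pw5Prog`), (ii) ONE panel file `SAlphaPolyWitnessS15A095Panels0` (11 kernel-decided Taylor-model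
integral enclosures of the density on a GRADED grid of `[0, 8]` — panel half-widths `1/2` on `[0, 6]`, `1/4` on `[6, 15/2]`, `1/8` on `[15/2, 8]` — glued by `FSegOK.append`, a change of grid after
rewriting the common endpoint), and (iii) here: `Poly.deriv UX = UXd` (`decide`), the exact zeros `X(±8) = 0`, parity (`X` even, `X′` odd ⇒ density
even ⇒ `W[X; −8, 8] = 2∫₀^8`), `FSegOK.bounds`, and lit-3's predicate `SAlpha.UnstableWitness`.  0 kit in the kernel objects; no `native_decide`;
`π` does not enter.

## THREE COLUMNS
CERTIFIED: in the `s–α` ballooning MODEL (Freidberg (12.96)–(12.99)) at `(s, α) = (3/2, 19/20)` the explicit trial function `X = Poly.eval UX` on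
`[−8, 8]` (even polynomial of degree 26 vanishing at `±8`) has one-surface energy `W ≤ -3/50 < 0` (`X(0) ≈ 1`):
`SAlpha.UnstableWitness (3/2) (19/20) (−8) 8 X X′` (`unstableWitness_threeHalves_095`).  With gridfusion-lit-4's ★ #220 `SAlphaStableS15A075.stableSide : SAlpha.StableSide (3/2) (3/4)`
the unstable set `U` of the MODEL at shear `s = 3/2` (the `α` at which some compact window carries a witness) misses `3/4` and contains `19/20`
(and `21/20`, `★ #192 `SAlphaTwoTurnBump.unstableWitness_tt_threehalves_105``): `inf {α ≥ 3/4 : α ∈ U}` lies in the CLOSED interval `[3/4, 19/20]` (width `1/5`; NOT yet a halving of `[3/4, 21/20]` (width `3/10`));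
monotonicity / continuity in `α` NOT typed.  VALIDATED (not in the kernel): E–L shooting puts the edge at `α ≈ 0.885` (lit-4 kit j299948 / j301608;
model-7 RK4: first zero of the even solution at `θ ≈ 5.22` for `α = 19/20`); float energy of `X` `≈ -0.0674`, kernel enclosure of the
half integral `[−0.033912, −0.033466]`; the printed fit `α ≈ 0.6 s` (12.100) gives `0.9`.  MODELLED: `s–α` model (large-aspect-ratio shifted circles,
high-`n` ballooning ordering, `θ₀ = 0`, ideal MHD); «unstable» = the MODEL's one-surface energy admits a negative compactly supported trial function
(lit-3's witness class; representation step `W̄ < 0 ⇒ δW < 0`, Connor–Hastie–Taylor 1979, quoted in the Literature file, NOT typed); no device, no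
`β`-limit, no second-stability claim.  Citations: Freidberg 2014 §12.3 (12.38)–(12.40), §12.6.2 (12.97)–(12.100) [Freidberg2014];
Mahboubi–Melquiond–Sibut-Pinote 2016 [MahboubiMelquiondSibutpinote2016]; Makino–Berz 2003 [MakinoBerz2003].  Everything below is [instance data].
-/

open MeasureTheory
open Literature.Analysis.ValidatedNumerics Literature.Analysis.ValidatedNumerics.PolyMP
open Literature.Analysis.ValidatedNumerics.NumericsMP Literature.Analysis.ValidatedNumerics.ExpPoly
open Literature.MathematicalPhysics.MHD.Ballooning
open Real Set

namespace Summit.Ventures.FusionMHD.Models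

namespace SAlphaPolyWitnessS15A095

/-! ### §1 The trial function: derivative, zeros at `±8`, parity -/

/-- `Poly.deriv UX = UXd`. [instance data] -/
private theorem deriv_UX : Poly.deriv UX = UXd := by
  decide +kernel

/-- `X(8) = 0` (exact). [instance data] -/
private theorem UX_at_L : Poly.eval UX (8 : ℝ) = 0 := by
  norm_num [UX, Poly.eval]

/-- `X(−8) = 0` (exact). [instance data] -/
private theorem UX_at_negL : Poly.eval UX (-8 : ℝ) = 0 := by
  norm_num [UX, Poly.eval]

/-- `X` is even. [instance data] -/
private theorem UX_even (θ : ℝ) : Poly.eval UX (-θ) = Poly.eval UX θ := by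
  simp only [UX, Poly.eval]
  push_cast
  ring

/-- `X′` is odd. [instance data] -/
private theorem UXd_odd (θ : ℝ) : Poly.eval UXd (-θ) = -Poly.eval UXd θ := by
  simp only [UXd, Poly.eval]
  push_cast
  ring

/-- `X′ = Poly.eval UXd` is the derivative of `X = Poly.eval UX` everywhere. [instance data] -/
private theorem hasDerivAt_UX (θ : ℝ) : HasDerivAt (Poly.eval UX) (Poly.eval UXd θ) θ := by
  have h := Poly.hasDerivAt_eval UX θ
  rwa [deriv_UX] at h

/-! ### §2 The energy density of `X`: parity, continuity, the certified half-window integral -/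

/-- The energy density of the even `X` is even in `θ`. [instance data] -/
private theorem density_even (θ : ℝ) : (SAlpha.energyDensity (3 / 2) (19 / 20) (Poly.eval UX) (Poly.eval UXd)) (-θ) = (SAlpha.energyDensity (3 / 2) (19 / 20) (Poly.eval UX) (Poly.eval UXd)) θ := by
  unfold SAlpha.energyDensity SAlpha.bending SAlpha.drive SAlpha.shearParam
  rw [UX_even, UXd_odd, Real.sin_neg, Real.cos_neg]
  ring

/-- The energy density of `X` is continuous. [instance data] -/
private theorem density_continuous : Continuous (SAlpha.energyDensity (3 / 2) (19 / 20) (Poly.eval UX) (Poly.eval UXd)) := by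
  have h1 : Continuous (Poly.eval UX) := Poly.continuous_eval UX
  have h2 : Continuous (Poly.eval UXd) := Poly.continuous_eval UXd
  unfold SAlpha.energyDensity SAlpha.bending SAlpha.drive SAlpha.shearParam
  fun_prop

/-- THE CERTIFIED HALF-WINDOW INTEGRAL: `∫₀^8 [(1+Λ²)X′² − α(Λ sin θ + cos θ)X²] dθ ≤ -3/100` (kernel enclosure of the 11 panels:
`[-0.033911, -0.033467]`; float value `-0.033686`). [instance data] -/
theorem half_integral_le : ∫ θ in (0 : ℝ)..8, (SAlpha.energyDensity (3 / 2) (19 / 20) (Poly.eval UX) (Poly.eval UXd)) θ ≤ (-3 / 100 : ℝ) := by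
  have hseg := pw5_seg0
  have hb := (hseg.bounds (by norm_num) (lo' := -1) (hi' := -3/100) (by norm_num) (by norm_num)).2
  have e0 : ((panelLeft (1/2 : ℚ) 0 : ℚ) : ℝ) = 0 := by norm_num [panelLeft]
  have e1 : ((panelLeft (1/8 : ℚ) 32 : ℚ) : ℝ) = 8 := by norm_num [panelLeft]
  have ei : ∀ t : ℝ, (TProg.toFunP (pw5Prog UX UXd) []) t * Poly.eval [1] t = (SAlpha.energyDensity (3 / 2) (19 / 20) (Poly.eval UX) (Poly.eval UXd)) t := by
    intro t
    rw [toFunP_pw5Prog]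
    simp [Poly.eval]
  rw [e0, e1] at hb
  simp only [ei] at hb
  norm_num at hb ⊢
  exact hb

/-- THE CERTIFIED ENERGY: `W[X; −8, 8] ≤ -3/50 < 0` (reflection `θ ↦ −θ` doubles the half-window integral). [instance data] -/
theorem energy_le : SAlpha.energy (3 / 2) (19 / 20) (Poly.eval UX) (Poly.eval UXd) (-8) 8 ≤ (-3 / 50 : ℝ) := by
  unfold SAlpha.energy
  have hint : ∀ a b : ℝ, IntervalIntegrable (SAlpha.energyDensity (3 / 2) (19 / 20) (Poly.eval UX) (Poly.eval UXd)) volume a b :=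
    fun a b => density_continuous.intervalIntegrable a b
  have hsplit := intervalIntegral.integral_add_adjacent_intervals (hint (-8) 0) (hint 0 8)
  have hrefl : ∫ θ in (-8 : ℝ)..0, (SAlpha.energyDensity (3 / 2) (19 / 20) (Poly.eval UX) (Poly.eval UXd)) θ = ∫ θ in (0 : ℝ)..8, (SAlpha.energyDensity (3 / 2) (19 / 20) (Poly.eval UX) (Poly.eval UXd)) θ := by
    have h1 := intervalIntegral.integral_comp_neg (a := (0 : ℝ)) (b := 8) (SAlpha.energyDensity (3 / 2) (19 / 20) (Poly.eval UX) (Poly.eval UXd))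
    simp only [neg_zero] at h1
    rw [← h1]
    exact intervalIntegral.integral_congr fun x _ => density_even x
  have hh := half_integral_le
  linarith

/-! ### §3 The witness -/

/-- **THE ROW: `(s, α) = (3/2, 19/20)` IS ON THE UNSTABLE SIDE OF THE `s–α` MODEL** — the explicit even polynomial `X = Poly.eval UX`
(degree 26, `X(±8) = 0`) is a compactly supported trial function on the window `[−8, 8]` with NEGATIVE one-surface energy
(`≤ -3/50` with `X(0) ≈ 1`), i.e. an `SAlpha.UnstableWitness 3/2 (19/20) (−8) 8`.  MODEL `s–α`; «unstable» in the model's own one-surface (Newcomb / trial-function)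
sense; nothing about a device. [instance data] -/
theorem unstableWitness_threeHalves_095 : SAlpha.UnstableWitness (3 / 2) (19 / 20) (-8) 8 (Poly.eval UX) (Poly.eval UXd) := by
  refine ⟨by norm_num, fun θ _ => hasDerivAt_UX θ, UX_at_negL, UX_at_L, ?_⟩
  have h := energy_le
  linarith

end SAlphaPolyWitnessS15A095

end Summit.Ventures.FusionMHD.Models
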